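import Literature.NumberTheory.DiophantineGeometry.AVIsogenyTateFinrankHomAssemblyProofs
import Literature.NumberTheory.DiophantineGeometry.AVIsogenyTateHomDegBoundProofs
import Literature.AlgebraicGeometry.Motives.AbelianVarietyEndDegreeBound
import HarnessLib

/-!
# Mumford §19, Theorem 3 and Corollary 1 from the Theorem of the Cube and Poincaré reducibility

Third assembly file for the named fact
`Literature.AlgebraicGeometry.Motives.AbelianVariety.finrank_hom_le` of `AVIsogenyTate`
(`rank_ℤ Hom(A, B) ≤ 4 dim A dim B`; D. Mumford, *Abelian Varieties*, §19, Corollary 1 of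
Theorem 3; J. S. Milne, *Abelian Varieties* (1986), Theorem 12.5), after
`AVIsogenyTateFinrankHomProofs` (Cor. 1 ⇐ Thm. 3 + `T_ℓ A ≅ ℤ_ℓ^{2 dim A}`) and
`AVIsogenyTateFinrankHomAssemblyProofs` (Cor. 1 ⇐ `module_finite_hom` + torsion counts; ⇐ Mumford's
printed statements `h₀`, `hP1`, `hsimple`, `hdeg`, `hA`, `hB`).

Since then the tree has reduced every *geometric* input of those assemblies that concerns a single
abelian variety to the Theorem of the Cube (`theoremOfCube_linEquiv`, Görtz–Wedhorn II, Thm. 24.73,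
the named fact of `Motives/AbelianVarietyTheoremOfCube`), and the Theorem of the Cube itself to the
pseudo-coherence of the Čech complex of `𝒪(D)` (`cechComplex_pseudoCoherent_general`,
Görtz–Wedhorn II, Thm. 23.133 / Cor. 23.135 — finiteness of coherent cohomology of proper
morphisms; `theoremOfCube_linEquiv_of_pseudoCoherent_general`,
`Motives/AbelianVarietyTheoremOfCubeProofs`):

* `[n]_X` is an isogeny for `n ≠ 0` (§6 App. 2): `isIsogeny_zsmul_id_of_theoremOfCube_linEquiv`
  (`Motives/AbelianVarietyTorsionCubeProofs`);
* `deg [n]_X = n^{2 dim X}` (§6 App. 3): `kerRank_zsmul_id_of_theoremOfCube_linEquiv`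
  (`Motives/AbelianVarietyKerRankOfCube`);
* `#X[n](K̄) = n^{2 dim X}` for `n` invertible in `K` (§6 Prop. p. 64):
  `natCard_torsionPoints_of_isAlgClosed_of_theoremOfCube_linEquiv` (ibid.);
* the degree bound `deg (∑ nᵢ eᵢ) ≤ C_e (∑ |nᵢ|)^{2 dim X}` on `End(X)` for `X` all of whose non-zero
  endomorphisms are isogenies — the form of §19 Thm. 2 that the proof of Thm. 3 consumes:
  `kerRank_sum_le_of_theoremOfCube` (`Motives/AbelianVarietyEndDegreeBound`), feeding Step I of the
  printed proof in the form `exists_fg_saturation_end_of_degBound` and Theorem 3 in the form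
  `module_finite_hom_of_mumford19_of_degBound` (`AVIsogenyTateHomDegBoundProofs`).

This file records the resulting trust base of §19 Thm. 3 and Cor. 1: **the Theorem of the Cube
(equivalently here: the pseudo-coherence of the Čech complex) together with the two statements of
§19 that concern pairs of abelian varieties and are not in the tree — Poincaré's complete
reducibility theorem (`hP1`, §19 Thm. 1: an abelian subvariety `Y ⊂ X` has a complement `Z` with
`Y ⊞ Z → X` an isogeny; or its two-sided splitting form `hP`) and "a non-zero homomorphism between
simple abelian varieties is an isogeny" (`hsimple`, §19 Cor. 2 of Thm. 1)** — for all four named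
facts of the `Theorems` section of `AVIsogenyTate`:

* `AbelianVariety.module_finite_hom_of_theoremOfCube_of_poincare` (Thm. 3, finite generation),
  `AbelianVariety.module_finite_hom_of_theoremOfCube_of_isogeny_biprod` (the same from `hP`);
* `AbelianVariety.module_free_hom_of_theoremOfCube_of_poincare` (Thm. 3 with Cor. 1, freeness);
* `AbelianVariety.faltingsTateMap_injective_of_theoremOfCube_of_poincare` (Thm. 3, injectivity of
  `ℤ_ℓ ⊗ Hom(A, B) → Hom(T_ℓ A, T_ℓ B)`);
* `AbelianVariety.finrank_hom_le_of_theoremOfCube_of_poincare` (Cor. 1, the rank bound),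
  `AbelianVariety.finrank_hom_le_of_theoremOfCube_of_isogeny_biprod` (from `hP`);
* `AbelianVariety.module_finite_hom_of_pseudoCoherent_general_of_poincare`,
  `AbelianVariety.module_free_hom_of_pseudoCoherent_general_of_poincare`,
  `AbelianVariety.faltingsTateMap_injective_of_pseudoCoherent_general_of_poincare`,
  `AbelianVariety.finrank_hom_le_of_pseudoCoherent_general_of_poincare` — the same four with the
  cube supplied by `cechComplex_pseudoCoherent_general`.

Granted `theoremOfCube_linEquiv_holds` (or `cechComplex_pseudoCoherent_general_holds`) and proofs
of `hP1`, `hsimple`, the discharge `finrank_hom_le_holds` is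
`finrank_hom_le_of_theoremOfCube_of_poincare theoremOfCube_linEquiv_holds hP1 hsimple A B`; it is
**not** asserted here.

## References

* [MumfordAV1970] D. Mumford, *Abelian Varieties*, TIFR Studies in Mathematics 5, OUP (1970):
  §19, Thm. 3 with its proof and Cor. 1 (pp. 176–178 of the 2nd ed.), Thm. 1 with Cor. 1–2
  (pp. 173–174), Thm. 2 (p. 174); §6, App. 2–3 and Prop. p. 64; §6 Cor. 2 (p. 58). Not held;
  architecture as in Milne 1986, §12.
* [Milne1986AbelianVarieties] J. S. Milne, *Abelian Varieties*, in: Cornell–Silverman (eds.),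
  *Arithmetic Geometry*, Springer 1986, Thm. 12.5, Lemmas 12.6–12.7, Prop. 12.1 (held:
  `book:cornellnd-arithmetic-geometry`, PDF pp. 190–192).
* [GortzWedhorn2023] U. Görtz, T. Wedhorn, *Algebraic Geometry II*, Springer 2023: Thm. 24.73
  (p. 550), Thm. 23.133 / Cor. 23.135 (pp. 478–480), Prop. 27.167, 27.174, 27.184–27.188
  (pp. 877–888).

## Design

No definitions, no named facts (D-0026): every declaration is a theorem; `hP1`, `hP`, `hsimple` are
spelled verbatim as in `AVIsogenyTateHomPoincareProofs` / `AVIsogenyTateHomDegBoundProofs`, so that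
the theorems there apply by name. A leaf file (nothing imports it), importing the two ends it
joins: the `Hom`-side assembly (`AVIsogenyTateFinrankHomAssemblyProofs`,
`AVIsogenyTateHomDegBoundProofs`) and the cube-side degree bound
(`Motives/AbelianVarietyEndDegreeBound`, which brings `Motives/AbelianVarietyKerRankOfCube`,
`Motives/AbelianVarietyTorsionCubeProofs` and `Motives/AbelianVarietyTheoremOfCubeProofs`).
-/

universe u

open CategoryTheory CategoryTheory.Limits AlgebraicGeometry

noncomputable section

namespace Literature.NumberTheory.DiophantineGeometry

section AbelianVariety
open Literature.AlgebraicGeometry.Motives (AbelianVariety theoremOfCube_linEquiv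
  cechComplex_pseudoCoherent_general theoremOfCube_linEquiv_of_pseudoCoherent_general)
open Literature.AlgebraicGeometry.Motives.AbelianVariety

variable {K : Type u} [Field K]

/-! ### Theorem 3 and Corollary 1 from the Theorem of the Cube, `hP1`/`hP` and `hsimple` -/

open Classical in
/-- **Mumford §19, Theorem 3 (`Hom(A, B)` finitely generated) from the Theorem of the Cube,
Poincaré's complete reducibility theorem and "non-zero homomorphisms between simple abelian
varieties are isogenies".** The named fact `module_finite_hom A B` follows from
`theoremOfCube_linEquiv` (Görtz–Wedhorn II, Thm. 24.73), `hP1` (§19 Thm. 1: a complement `Z` of an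
abelian subvariety `Y ⊂ X` with `Y ⊞ Z → X` an isogeny) and `hsimple` (§19 Cor. 2 of Thm. 1):
`module_finite_hom_of_mumford19_of_degBound` with its single-variety inputs discharged from the cube —
`[n]_X` an isogeny (`isIsogeny_zsmul_id_of_theoremOfCube_linEquiv`, §6 App. 2), `deg [n]_X = n^{2g}`
(`kerRank_zsmul_id_of_theoremOfCube_linEquiv`, §6 App. 3), the degree bound on `End(X)` for simple
`X` (`kerRank_sum_le_of_theoremOfCube`, the consumed form of §19 Thm. 2) and the torsion counts of
`A`, `B` (`natCard_torsionPoints_of_isAlgClosed_of_theoremOfCube_linEquiv`, §6 Prop. p. 64).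
[cite: MumfordAV1970, §19 Thm. 3] [cite: Milne1986AbelianVarieties, Thm. 12.5 (PDF pp. 190–192)] -/
theorem _root_.Literature.AlgebraicGeometry.Motives.AbelianVariety.module_finite_hom_of_theoremOfCube_of_poincare
    (hcube : theoremOfCube_linEquiv.{u})
    (hP1 : ∀ (X Y : AbelianVariety K) (i : Y ⟶ X), IsClosedImmersion (Hom.toSchemeHom i) →
      0 < Y.dim → Y.dim < X.dim →
      ∃ (Z : AbelianVariety K) (j : Z ⟶ X), IsClosedImmersion (Hom.toSchemeHom j) ∧
        IsIsogeny (biprod.desc i j))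
    (hsimple : ∀ (X Y : AbelianVariety K), IsSimple X → IsSimple Y →
      ∀ f : X ⟶ Y, f ≠ 0 → IsIsogeny f)
    (A B : AbelianVariety K) : module_finite_hom A B :=
  module_finite_hom_of_mumford19_of_degBound
    (fun X => X.isIsogeny_zsmul_id_of_theoremOfCube_linEquiv hcube)
    (fun X _ _ => X.kerRank_zsmul_id_of_theoremOfCube_linEquiv hcube) hP1 hsimple
    (fun X hX hXpos => kerRank_sum_le_of_theoremOfCube hcube X (hsimple X X hX hX) hXpos) A B
    (A.natCard_torsionPoints_of_isAlgClosed_of_theoremOfCube_linEquiv (AlgebraicClosure K) hcube)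
    (B.natCard_torsionPoints_of_isAlgClosed_of_theoremOfCube_linEquiv (AlgebraicClosure K) hcube)

open Classical in
/-- **Mumford §19, Theorem 3 (`Hom(A, B)` finitely generated) from the Theorem of the Cube,
`hsimple` and Poincaré reducibility in two-sided splitting form** (`hP`: a non-simple `X` admits
isogenies `X₁ ⊞ X₂ → X`, `X → X₁ ⊞ X₂` with `dim Xᵢ < dim X`; §19 Thm. 1 with Cor. 1 and the
Remark p. 169): `module_finite_hom_of_poincare_of_degBound` with the single-variety inputs from the
cube, as in `module_finite_hom_of_theoremOfCube_of_poincare`. [cite: MumfordAV1970, §19 Thm. 3] -/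
theorem _root_.Literature.AlgebraicGeometry.Motives.AbelianVariety.module_finite_hom_of_theoremOfCube_of_isogeny_biprod
    (hcube : theoremOfCube_linEquiv.{u})
    (hsimple : ∀ (X Y : AbelianVariety K), IsSimple X → IsSimple Y →
      ∀ f : X ⟶ Y, f ≠ 0 → IsIsogeny f)
    (hP : ∀ X : AbelianVariety K, ¬ IsSimple X → ∃ X₁ X₂ : AbelianVariety K,
      X₁.dim < X.dim ∧ X₂.dim < X.dim ∧ (∃ σ : X₁ ⊞ X₂ ⟶ X, IsIsogeny σ) ∧
        ∃ τ : X ⟶ X₁ ⊞ X₂, IsIsogeny τ)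
    (A B : AbelianVariety K) : module_finite_hom A B :=
  module_finite_hom_of_poincare_of_degBound
    (fun X => X.isIsogeny_zsmul_id_of_theoremOfCube_linEquiv hcube)
    (fun X _ _ => X.kerRank_zsmul_id_of_theoremOfCube_linEquiv hcube) hsimple
    (fun X hX hXpos => kerRank_sum_le_of_theoremOfCube hcube X (hsimple X X hX hX) hXpos) hP A B
    (A.natCard_torsionPoints_of_isAlgClosed_of_theoremOfCube_linEquiv (AlgebraicClosure K) hcube)
    (B.natCard_torsionPoints_of_isAlgClosed_of_theoremOfCube_linEquiv (AlgebraicClosure K) hcube)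

/-- **Mumford §19, Theorem 3 with Corollary 1 (`Hom(A, B)` is free) from the Theorem of the Cube,
`hP1` and `hsimple`**: finitely generated (`module_finite_hom_of_theoremOfCube_of_poincare`) and
torsion-free because `[n]_A` is an isogeny (`isIsogeny_zsmul_id_of_theoremOfCube_linEquiv`), hence
free over the PID `ℤ` (`module_free_hom_of_module_finite_hom_of_isIsogeny_zsmul_id`,
`AVIsogenyTateFreeHomProofs`). [cite: MumfordAV1970, §19 Thm. 3 and Cor. 1] -/
theorem _root_.Literature.AlgebraicGeometry.Motives.AbelianVariety.module_free_hom_of_theoremOfCube_of_poincare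
    (hcube : theoremOfCube_linEquiv.{u})
    (hP1 : ∀ (X Y : AbelianVariety K) (i : Y ⟶ X), IsClosedImmersion (Hom.toSchemeHom i) →
      0 < Y.dim → Y.dim < X.dim →
      ∃ (Z : AbelianVariety K) (j : Z ⟶ X), IsClosedImmersion (Hom.toSchemeHom j) ∧
        IsIsogeny (biprod.desc i j))
    (hsimple : ∀ (X Y : AbelianVariety K), IsSimple X → IsSimple Y →
      ∀ f : X ⟶ Y, f ≠ 0 → IsIsogeny f)
    (A B : AbelianVariety K) : module_free_hom A B :=
  module_free_hom_of_module_finite_hom_of_isIsogeny_zsmul_id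
    (module_finite_hom_of_theoremOfCube_of_poincare hcube hP1 hsimple A B)
    (A.isIsogeny_zsmul_id_of_theoremOfCube_linEquiv hcube)

/-- **Mumford §19, Theorem 3 (injectivity of `ℤ_ℓ ⊗ Hom(A, B) → Hom_{Γ_K}(T_ℓ A, T_ℓ B)` for every
prime `ℓ` invertible in `K`) from the Theorem of the Cube, `hP1` and `hsimple`**: the named fact
`faltingsTateMap_injective A B` follows from finite generation alone
(`faltingsTateMap_injective_of_module_finite_hom`, Milne 1986, proof of Thm. 12.5 with Lemma 12.6),
and finite generation is `module_finite_hom_of_theoremOfCube_of_poincare`.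
[cite: MumfordAV1970, §19 Thm. 3] [cite: Milne1986AbelianVarieties, Thm. 12.5 (PDF pp. 190–192)] -/
theorem _root_.Literature.AlgebraicGeometry.Motives.AbelianVariety.faltingsTateMap_injective_of_theoremOfCube_of_poincare
    (hcube : theoremOfCube_linEquiv.{u})
    (hP1 : ∀ (X Y : AbelianVariety K) (i : Y ⟶ X), IsClosedImmersion (Hom.toSchemeHom i) →
      0 < Y.dim → Y.dim < X.dim →
      ∃ (Z : AbelianVariety K) (j : Z ⟶ X), IsClosedImmersion (Hom.toSchemeHom j) ∧
        IsIsogeny (biprod.desc i j))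
    (hsimple : ∀ (X Y : AbelianVariety K), IsSimple X → IsSimple Y →
      ∀ f : X ⟶ Y, f ≠ 0 → IsIsogeny f)
    (A B : AbelianVariety K) : faltingsTateMap_injective A B :=
  faltingsTateMap_injective_of_module_finite_hom A B
    (module_finite_hom_of_theoremOfCube_of_poincare hcube hP1 hsimple A B)

/-- **Mumford §19, Corollary 1 of Theorem 3 (`rank_ℤ Hom(A, B) ≤ 4 dim A dim B`) from the Theorem
of the Cube, Poincaré's complete reducibility theorem and "non-zero homomorphisms between simple
abelian varieties are isogenies".** The named fact `finrank_hom_le A B` follows from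
`theoremOfCube_linEquiv` (Görtz–Wedhorn II, Thm. 24.73), `hP1` (§19 Thm. 1) and `hsimple` (§19
Cor. 2 of Thm. 1): Theorem 3 is `module_finite_hom_of_theoremOfCube_of_poincare`, the torsion counts
`#A[n](K̄) = n^{2 dim A}`, `#B[n](K̄) = n^{2 dim B}` (whence `T_ℓ ≅ ℤ_ℓ^{2 dim}`) are
`natCard_torsionPoints_of_isAlgClosed_of_theoremOfCube_linEquiv`, and Corollary 1 is then
`finrank_hom_le_of_module_finite_hom` ("clearly it suffices to prove the second statement",
Milne 1986, proof of Thm. 12.5). Granted `theoremOfCube_linEquiv_holds` and proofs of `hP1`,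
`hsimple`, `finrank_hom_le_holds` is this theorem applied to them.
[cite: MumfordAV1970, §19 Cor. 1 of Thm. 3] [cite: Milne1986AbelianVarieties, Thm. 12.5 (PDF p. 190)] -/
theorem _root_.Literature.AlgebraicGeometry.Motives.AbelianVariety.finrank_hom_le_of_theoremOfCube_of_poincare
    (hcube : theoremOfCube_linEquiv.{u})
    (hP1 : ∀ (X Y : AbelianVariety K) (i : Y ⟶ X), IsClosedImmersion (Hom.toSchemeHom i) →
      0 < Y.dim → Y.dim < X.dim →
      ∃ (Z : AbelianVariety K) (j : Z ⟶ X), IsClosedImmersion (Hom.toSchemeHom j) ∧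
        IsIsogeny (biprod.desc i j))
    (hsimple : ∀ (X Y : AbelianVariety K), IsSimple X → IsSimple Y →
      ∀ f : X ⟶ Y, f ≠ 0 → IsIsogeny f)
    (A B : AbelianVariety K) : finrank_hom_le A B :=
  finrank_hom_le_of_module_finite_hom A B
    (module_finite_hom_of_theoremOfCube_of_poincare hcube hP1 hsimple A B)
    (A.natCard_torsionPoints_of_isAlgClosed_of_theoremOfCube_linEquiv (AlgebraicClosure K) hcube)
    (B.natCard_torsionPoints_of_isAlgClosed_of_theoremOfCube_linEquiv (AlgebraicClosure K) hcube)

/-- **Mumford §19, Corollary 1 of Theorem 3 from the Theorem of the Cube, `hsimple` and Poincaré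
reducibility in two-sided splitting form `hP`** (§19 Thm. 1 with Cor. 1): as
`finrank_hom_le_of_theoremOfCube_of_poincare`, with Theorem 3 from
`module_finite_hom_of_theoremOfCube_of_isogeny_biprod`. [cite: MumfordAV1970, §19 Cor. 1 of Thm. 3] -/
theorem _root_.Literature.AlgebraicGeometry.Motives.AbelianVariety.finrank_hom_le_of_theoremOfCube_of_isogeny_biprod
    (hcube : theoremOfCube_linEquiv.{u})
    (hsimple : ∀ (X Y : AbelianVariety K), IsSimple X → IsSimple Y →
      ∀ f : X ⟶ Y, f ≠ 0 → IsIsogeny f)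
    (hP : ∀ X : AbelianVariety K, ¬ IsSimple X → ∃ X₁ X₂ : AbelianVariety K,
      X₁.dim < X.dim ∧ X₂.dim < X.dim ∧ (∃ σ : X₁ ⊞ X₂ ⟶ X, IsIsogeny σ) ∧
        ∃ τ : X ⟶ X₁ ⊞ X₂, IsIsogeny τ)
    (A B : AbelianVariety K) : finrank_hom_le A B :=
  finrank_hom_le_of_module_finite_hom A B
    (module_finite_hom_of_theoremOfCube_of_isogeny_biprod hcube hsimple hP A B)
    (A.natCard_torsionPoints_of_isAlgClosed_of_theoremOfCube_linEquiv (AlgebraicClosure K) hcube)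
    (B.natCard_torsionPoints_of_isAlgClosed_of_theoremOfCube_linEquiv (AlgebraicClosure K) hcube)

/-! ### The same from the pseudo-coherence of the Čech complex (GW II, Thm. 23.133 / Cor. 23.135) -/

/-- **Mumford §19, Theorem 3 (`Hom(A, B)` finitely generated) from the pseudo-coherence of the Čech
complex of `𝒪(D)`, `hP1` and `hsimple`**: `module_finite_hom_of_theoremOfCube_of_poincare` with the
Theorem of the Cube supplied by `theoremOfCube_linEquiv_of_pseudoCoherent_general` (Görtz–Wedhorn II,
Thm. 24.73 from Thm. 23.133 / Cor. 23.135; `Motives/AbelianVarietyTheoremOfCubeProofs`).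
[cite: MumfordAV1970, §19 Thm. 3] [cite: GortzWedhorn2023, Thm. 24.73 (p. 550) with Thm. 23.133 / Cor. 23.135 (pp. 478–480)] -/
theorem _root_.Literature.AlgebraicGeometry.Motives.AbelianVariety.module_finite_hom_of_pseudoCoherent_general_of_poincare
    (h : cechComplex_pseudoCoherent_general.{u})
    (hP1 : ∀ (X Y : AbelianVariety K) (i : Y ⟶ X), IsClosedImmersion (Hom.toSchemeHom i) →
      0 < Y.dim → Y.dim < X.dim →
      ∃ (Z : AbelianVariety K) (j : Z ⟶ X), IsClosedImmersion (Hom.toSchemeHom j) ∧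
        IsIsogeny (biprod.desc i j))
    (hsimple : ∀ (X Y : AbelianVariety K), IsSimple X → IsSimple Y →
      ∀ f : X ⟶ Y, f ≠ 0 → IsIsogeny f)
    (A B : AbelianVariety K) : module_finite_hom A B :=
  module_finite_hom_of_theoremOfCube_of_poincare (theoremOfCube_linEquiv_of_pseudoCoherent_general h)
    hP1 hsimple A B

/-- **Mumford §19, Theorem 3 with Corollary 1 (`Hom(A, B)` is free) from the pseudo-coherence of
the Čech complex of `𝒪(D)`, `hP1` and `hsimple`** (`module_free_hom_of_theoremOfCube_of_poincare`
with `theoremOfCube_linEquiv_of_pseudoCoherent_general`). [cite: MumfordAV1970, §19 Thm. 3 and Cor. 1]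
[cite: GortzWedhorn2023, Thm. 24.73 (p. 550) with Thm. 23.133 / Cor. 23.135 (pp. 478–480)] -/
theorem _root_.Literature.AlgebraicGeometry.Motives.AbelianVariety.module_free_hom_of_pseudoCoherent_general_of_poincare
    (h : cechComplex_pseudoCoherent_general.{u})
    (hP1 : ∀ (X Y : AbelianVariety K) (i : Y ⟶ X), IsClosedImmersion (Hom.toSchemeHom i) →
      0 < Y.dim → Y.dim < X.dim →
      ∃ (Z : AbelianVariety K) (j : Z ⟶ X), IsClosedImmersion (Hom.toSchemeHom j) ∧
        IsIsogeny (biprod.desc i j))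
    (hsimple : ∀ (X Y : AbelianVariety K), IsSimple X → IsSimple Y →
      ∀ f : X ⟶ Y, f ≠ 0 → IsIsogeny f)
    (A B : AbelianVariety K) : module_free_hom A B :=
  module_free_hom_of_theoremOfCube_of_poincare (theoremOfCube_linEquiv_of_pseudoCoherent_general h)
    hP1 hsimple A B

/-- **Mumford §19, Theorem 3 (injectivity of the Tate map) from the pseudo-coherence of the Čech
complex of `𝒪(D)`, `hP1` and `hsimple`** (`faltingsTateMap_injective_of_theoremOfCube_of_poincare`
with `theoremOfCube_linEquiv_of_pseudoCoherent_general`). [cite: MumfordAV1970, §19 Thm. 3]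
[cite: GortzWedhorn2023, Thm. 24.73 (p. 550) with Thm. 23.133 / Cor. 23.135 (pp. 478–480)] -/
theorem _root_.Literature.AlgebraicGeometry.Motives.AbelianVariety.faltingsTateMap_injective_of_pseudoCoherent_general_of_poincare
    (h : cechComplex_pseudoCoherent_general.{u})
    (hP1 : ∀ (X Y : AbelianVariety K) (i : Y ⟶ X), IsClosedImmersion (Hom.toSchemeHom i) →
      0 < Y.dim → Y.dim < X.dim →
      ∃ (Z : AbelianVariety K) (j : Z ⟶ X), IsClosedImmersion (Hom.toSchemeHom j) ∧
        IsIsogeny (biprod.desc i j))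
    (hsimple : ∀ (X Y : AbelianVariety K), IsSimple X → IsSimple Y →
      ∀ f : X ⟶ Y, f ≠ 0 → IsIsogeny f)
    (A B : AbelianVariety K) : faltingsTateMap_injective A B :=
  faltingsTateMap_injective_of_theoremOfCube_of_poincare
    (theoremOfCube_linEquiv_of_pseudoCoherent_general h) hP1 hsimple A B

/-- **Mumford §19, Corollary 1 of Theorem 3 (`rank_ℤ Hom(A, B) ≤ 4 dim A dim B`) from the
pseudo-coherence of the Čech complex of `𝒪(D)`, Poincaré's complete reducibility theorem and
"non-zero homomorphisms between simple abelian varieties are isogenies"** — the current trust base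
of the named fact `finrank_hom_le A B` in this tree: one named fact
(`cechComplex_pseudoCoherent_general`, Görtz–Wedhorn II, Thm. 23.133 / Cor. 23.135: finiteness of
coherent cohomology of proper morphisms, in Čech form) and the two printed statements `hP1` (§19
Thm. 1) and `hsimple` (§19 Cor. 2 of Thm. 1). `finrank_hom_le_of_theoremOfCube_of_poincare` with
`theoremOfCube_linEquiv_of_pseudoCoherent_general`. [cite: MumfordAV1970, §19 Cor. 1 of Thm. 3]
[cite: GortzWedhorn2023, Thm. 24.73 (p. 550) with Thm. 23.133 / Cor. 23.135 (pp. 478–480)] -/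
theorem _root_.Literature.AlgebraicGeometry.Motives.AbelianVariety.finrank_hom_le_of_pseudoCoherent_general_of_poincare
    (h : cechComplex_pseudoCoherent_general.{u})
    (hP1 : ∀ (X Y : AbelianVariety K) (i : Y ⟶ X), IsClosedImmersion (Hom.toSchemeHom i) →
      0 < Y.dim → Y.dim < X.dim →
      ∃ (Z : AbelianVariety K) (j : Z ⟶ X), IsClosedImmersion (Hom.toSchemeHom j) ∧
        IsIsogeny (biprod.desc i j))
    (hsimple : ∀ (X Y : AbelianVariety K), IsSimple X → IsSimple Y →
      ∀ f : X ⟶ Y, f ≠ 0 → IsIsogeny f)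
    (A B : AbelianVariety K) : finrank_hom_le A B :=
  finrank_hom_le_of_theoremOfCube_of_poincare (theoremOfCube_linEquiv_of_pseudoCoherent_general h)
    hP1 hsimple A B

end AbelianVariety

end Literature.NumberTheory.DiophantineGeometry
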